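import Mathlib
import Summits.Ventures.HodgeRepro.Tier3PadicComplexInt
import Summits.Ventures.HodgeRepro.Tier4.Line2.BranchCoefficients

/-!
# Tier4/Line2/Witness/BranchCoefficientsWitness — the R4 non-vacuity witness of `BranchCoefficients`
(seat t4-L2-p2, gen 0, on the lead's word S12348; blind re-derivation cell `pub-hodge-repro`, Tier 4, README §9–§10)

R4 (lead S12285 / S12338): every interface a line's lemmas quantify over must be WITNESSED — for a Mathlib-level
structure, by a Lean instance.  `BranchCoefficients` (`Tier4/Line2/BranchCoefficients.lean`, the coefficient ring
`O` of LINE L2's Katz measures with its embedding into `𝓞_ℂ_[p]`) is inhabited for EVERY prime `p` by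
`A := ℤ_[p]`, Mathlib's `p`-adic integers:

* `ℤ_[p]` is a complete discrete valuation ring with its `p`-adic uniform ring structure (Mathlib instances:
  `IsDiscreteValuationRing`, `IsAdicComplete (maximalIdeal ℤ_[p]) ℤ_[p]`, `IsUniformAddGroup`, `IsTopologicalRing`);
* `ℤ_[p] → 𝓞_ℂ_[p]` is the landed `padicIntToComplexInt` of Tier3PadicComplexInt (the restriction of
  `ℤ_[p] → ℚ_[p] → ℂ_[p]` to the unit ball), an isometry (`norm_algebraMap_padicInt`), hence injective, and
  continuous (`IsBoundedSMul ℤ_[p] 𝓞_ℂ_[p]` there);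
* `ℤ_[p] → ℂ_[p]` is the same map followed by the inclusion `𝓞_ℂ_[p] ⊆ ℂ_[p]` — packaged here as the explicit
  algebra `padicIntAlgebraComplex` (NOT a global instance) so that the scalar tower `ℤ_[p] → 𝓞_ℂ_[p] → ℂ_[p]` holds
  by `rfl`.

`witness p : BranchCoefficients` is the datum; `nonempty_branchCoefficients : Nonempty BranchCoefficients` the
R4 line.  Nothing here asserts anything about Hecke characters, Katz measures or `L`-values, and nothing here says
anything about the status of the Hodge conjecture for CM abelian varieties, which is NOT proved (HC_CM is NOT proved
by anyone in this repository).
-/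

set_option autoImplicit false

noncomputable section

namespace Summit.Ventures.HodgeRepro.Tier4.Line2

open Summit.Ventures.HodgeRepro.T3.R2Pinning

variable (p : ℕ) [Fact p.Prime]

/-- The `ℤ_[p]`-algebra structure of `ℂ_[p]` through `ℤ_[p] → ℚ_[p] → ℂ_[p]` (an explicit datum, not an instance;
its algebra map is `x ↦ ↑(algebraMap ℤ_[p] 𝓞_ℂ_[p] x)`, so the tower `ℤ_[p] → 𝓞_ℂ_[p] → ℂ_[p]` is definitional). -/
abbrev padicIntAlgebraComplex : Algebra ℤ_[p] ℂ_[p] :=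
  ((algebraMap ℚ_[p] ℂ_[p]).comp (algebraMap ℤ_[p] ℚ_[p])).toAlgebra

/-- The algebra map of `padicIntAlgebraComplex` is the inclusion of `algebraMap ℤ_[p] 𝓞_ℂ_[p]`. -/
theorem padicIntAlgebraComplex_algebraMap_eq (x : ℤ_[p]) :
    @algebraMap ℤ_[p] ℂ_[p] _ _ (padicIntAlgebraComplex p) x = ((algebraMap ℤ_[p] 𝓞_ℂ_[p] x : 𝓞_ℂ_[p]) : ℂ_[p]) :=
  rfl

/-- The scalar tower `ℤ_[p] → 𝓞_ℂ_[p] → ℂ_[p]` for `padicIntAlgebraComplex` (an explicit datum, not an instance). -/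
theorem padicIntScalarTower :
    @IsScalarTower ℤ_[p] 𝓞_ℂ_[p] ℂ_[p] _ _ (padicIntAlgebraComplex p).toSMul :=
  letI := padicIntAlgebraComplex p
  IsScalarTower.of_algebraMap_eq fun _ => rfl

/-- `ℤ_[p] → 𝓞_ℂ_[p]` is injective: it is an isometry (`norm_algebraMap_padicInt`). -/
theorem algebraMap_padicInt_injective : Function.Injective (algebraMap ℤ_[p] 𝓞_ℂ_[p]) := by
  intro x y hxy
  have h : ‖x - y‖ = 0 := by
    rw [← norm_algebraMap_padicInt p, map_sub, hxy, sub_self, norm_zero]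
  exact sub_eq_zero.mp (norm_eq_zero.mp h)

/-- **The R4 witness**: `BranchCoefficients` is inhabited for every prime `p`, by `A := ℤ_[p]` embedded in
`𝓞_ℂ_[p]` through the landed `padicIntToComplexInt`. -/
def witness : BranchCoefficients where
  p := p
  A := ℤ_[p]
  algebraMap_injective := algebraMap_padicInt_injective p
  algebraField := padicIntAlgebraComplex p
  scalarTower := padicIntScalarTower p

/-- `(witness p).p = p` (definitional; recorded for the record). -/
theorem witness_p : (witness p).p = p := rfl

/-- `(witness p).A = ℤ_[p]` (definitional; recorded for the record). -/
theorem witness_A : (witness p).A = ℤ_[p] := rfl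

/-- **R4 line**: `BranchCoefficients` is non-empty. -/
theorem nonempty_branchCoefficients : Nonempty BranchCoefficients :=
  ⟨witness 2⟩

end Summit.Ventures.HodgeRepro.Tier4.Line2
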